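import Summits.BirchSwinnertonDyer.BirchSwinnertonDyer.Theses.ShaPrimaryTransfer
import Summits.BirchSwinnertonDyer.BirchSwinnertonDyer.Theorems.ShaPrimaryTransferFiniteShaComponentTransferOddDoor
import Summits.BirchSwinnertonDyer.BirchSwinnertonDyer.Theorems.ShaPrimaryTransferFiniteShaComponentTransferSlices
import Literature.NumberTheory.EllipticCurves.ShaPrimaryLevelProfile
import Literature.NumberTheory.EllipticCurves.ShaPrimaryIsogenyKill
import HarnessLib

/-!
# BirchSwinnertonDyer / ShaPrimaryTransfer — crux `FiniteShaComponentTransfer` (stmt-BirchSwinnertonDyer-22356):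
# THE LEVEL PROFILE OF A Ш-COMPONENT, unconditionally; the second-descent door for O and T; T in
# level-profile currency; cross-prime squares; the isogeny-door table COMPLETED

Helper file of prover seat `bsd-line-spt-p1` g15 (`--supports stmt-22356 --as helper`). THEOREMS ONLY.
The route's crux T = `FiniteShaComponentTransfer` («`t_p(E) = 0 → t_q(E) = 0`», `t_p(E) = W.shaCorank p =
corank_{ℤ_p} Ш(E)[p^∞]`) and its door O = `OneFiniteShaComponent` are exercised by DESCENT instruments. The
route header promises that «complete 2-descent / 3-descent / 4-descent with the Cassels–Tate pairing decide
[`t_{p₀}(E) = 0`] curve by curve» — so far the tree could close a door only by `Ш(E)[p₀] = 0` on the curve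
(g4–g10) or on an isogenous curve (g11–g13). This file supplies the missing reading: what a descent AT EVERY
LEVEL `p^e` says about `t_p`, from the structure `Ш(E/K)[p^∞] ≅ (ℚ_p/ℤ_p)^{t_p} ⊕ L ⊕ L` (Literature
`ShaPrimaryLevelProfile`, `ZpCorankLevelProfile`: the tree's SymplecticModules + corank calculus), with the
Cassels–Tate hypothesis DISCHARGED by the tree theorem (`ShaPrimaryTransferOddDoor.casselsTate_pairing`,
re-deriving `WeierstrassCurve.exists_casselsTate_pairing_holds` of seat gk2-p1 g13).

* §1 UNCONDITIONAL LEVEL PROFILE over every number field `K : Type`: `#Ш(E/K)[p^e] = p^{e·t_p(E) + 2 m_e}`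
  (`exists_sha_levelProfile`); even levels are always squares; two consecutive levels: `#Ш[p^{e+1}] =
  p^{t_p + 2j}·#Ш[p^e]`, so **`t_p ≤ b − a`** from `#Ш[p^e] = p^a`, `#Ш[p^{e+1}] = p^b`; the `(p, p²)` table;
  **`t_p(E) = 0 ⟺ ∃ e, #Ш[p^{e+1}] = #Ш[p^e] ⟺ (#Ш[p^e])_e bounded`**.
* §2 THE SECOND-DESCENT DOOR for the route (`K = ℚ`): `#Ш(E)[p₀^{e+1}] = #Ш(E)[p₀^e]` (two consecutive complete
  descents agreeing — e.g. `#Ш[2] = #Ш[4]`, mwrank's second descent) is a WITNESS for O at `p₀`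
  (`door_of_natCard_succ_eq`), and granting T it propagates to `t_q(E) = 0`, hence to a bounded, eventually
  constant, all-even-levels-square profile at EVERY prime (`transfer_of_natCard_succ_eq`,
  `forall_exists_natCard_succ_eq_of_transfer`).
* §3 T IN LEVEL-PROFILE CURRENCY: **T ⟺ «if the level profile of `Ш(E)` stabilises at one prime it
  stabilises at every prime»** (`finiteShaComponentTransfer_iff_stabilisation`) ⟺ «bounded at one prime ⟹
  bounded at every prime» (`finiteShaComponentTransfer_iff_bounded`). ¬T's shape: a curve whose `p`-profile is
  eventually constant while its `q`-profile grows by `q^{t_q}`, `t_q ≥ 2` even (granting `p`-parity), forever.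
* §4 CROSS-PRIME SQUARES: at even levels `#Ш(E)[p^e]` is a square at EVERY prime unconditionally; at odd levels,
  granting the `p`-parity theorem at `p` and `q` (named fact `p_parity`), `#Ш(E)[p^e]` is a square iff
  `#Ш(E)[q^{e'}]` is (`isSquare_iff_isSquare_of_p_parity`) — the only cross-prime content in print, now at all levels.
* §5 THE ISOGENY-DOOR TABLE COMPLETED (Literature `ShaPrimaryIsogenyKill`): for the four carriers `X₈` (rank 0),
  `X₁₂₁` (rank 1), `X₃₄₆`, `X₃₈₈` (rank 2): **`Ш(X/ℚ)[2^∞] = Ш(X/ℚ)[2] ≅ ℤ/2 × ℤ/2`**, `#Ш(X)[2^e] = 4` for all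
  `e ≥ 1` (`m_e = 1`, `t_2 = 0`) — the first COMPLETELY DETERMINED non-zero `Ш`-primary components in the tree;
  granting T, `t_q(X) = 0` and every `#Ш(X)[q^e]` is a square, at every prime `q` (`isogenyDoorTable_complete_transfer`).

Nothing here proves T, O or BSD; T stays conjecture-grade at analytic rank ≥ 2.

## References

* R. Greenberg, LNM 1716 (1999), §1, pp. 54–57. [Greenberg1999LNM]
* T. Dokchitser, *Notes on the parity conjecture* (2013), §2. [Dokchitser2013ParityNotes]
* J. W. S. Cassels, J. reine angew. Math. 211 (1962), 95–112 (the pairing). [Cassels1962ArithmeticIV]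
* J. S. Milne, *Arithmetic Duality Theorems* (2006), I.6.13(a), I.7.1(b). [MilneADT2006]
* J. H. Silverman, *AEC* 2nd ed. (2009), X.4.2, X.4.14, X.6.5. [SilvermanAEC2009]
* T. and V. Dokchitser, Ann. of Math. 172 (2010), Thm. 1.4 (the `p`-parity theorem). [DokchitserDokchitserAnnals2010]
-/

-- D-0017: single-problem summit, so `Summit.BirchSwinnertonDyer.BirchSwinnertonDyer.…` repeats a namespace BY DESIGN.
set_option linter.dupNamespace false

noncomputable section

namespace Summit.BirchSwinnertonDyer.BirchSwinnertonDyer.Theorems.ShaPrimaryTransferLevelProfile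

open scoped Classical
open scoped AddSubgroup
open Summit.BirchSwinnertonDyer.BirchSwinnertonDyer.Theses.ShaPrimaryTransfer
  (FiniteShaComponentTransfer OneFiniteShaComponent)
open Summit.BirchSwinnertonDyer.BirchSwinnertonDyer.Theorems
open Literature.NumberTheory.EllipticCurves
open WeierstrassCurve

/-! ## §1 The level profile, unconditionally (every number field) -/

section AnyField

variable {K : Type} [Field K] [NumberField K] (W : WeierstrassCurve K) [W.IsElliptic] (p : ℕ) [hp : Fact p.Prime]

/-- **`#Ш(E/K)[p^e] = p^{e·t_p(E) + 2·m_e}` for every `e`, UNCONDITIONALLY** (`m` monotone, `m 0 = 0`, eventually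
constant): the Literature profile with its Cassels–Tate hypothesis discharged by the tree theorem.
[cite: Dokchitser2013ParityNotes, §2] [cite: Greenberg1999LNM, §1 (pp. 54–57)] -/
theorem exists_sha_levelProfile :
    ∃ m : ℕ → ℕ, m 0 = 0 ∧ Monotone m ∧ (∃ e₀ : ℕ, ∀ e, e₀ ≤ e → m e = m e₀) ∧
      ∀ e : ℕ, Nat.card (W.sha[((p ^ e : ℕ) : ℤ)]) = p ^ (e * W.shaCorank p + 2 * m e) :=
  Literature.NumberTheory.EllipticCurves.exists_sha_levelProfile W p ShaPrimaryTransferOddDoor.casselsTate_pairing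

/-- **`#Ш(E/K)[p^e]` is a square iff `e·t_p(E)` is even**, unconditionally; in particular `#Ш[p²]`, `#Ш[p⁴]`, …
are always squares. [cite: Dokchitser2013ParityNotes, §2] [cite: Cassels1962ArithmeticIV, §1] -/
theorem isSquare_natCard_sha_torsionBy_pow_iff (e : ℕ) :
    IsSquare (Nat.card (W.sha[((p ^ e : ℕ) : ℤ)])) ↔ Even (e * W.shaCorank p) :=
  Literature.NumberTheory.EllipticCurves.isSquare_natCard_sha_torsionBy_pow_iff W p
    ShaPrimaryTransferOddDoor.casselsTate_pairing e

/-- **Even levels are always squares**, unconditionally. [cite: Cassels1962ArithmeticIV, §1] -/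
theorem isSquare_natCard_sha_torsionBy_pow_of_even {e : ℕ} (he : Even e) :
    IsSquare (Nat.card (W.sha[((p ^ e : ℕ) : ℤ)])) :=
  Literature.NumberTheory.EllipticCurves.isSquare_natCard_sha_torsionBy_pow_of_even W p
    ShaPrimaryTransferOddDoor.casselsTate_pairing he

/-- **Two consecutive levels**: `#Ш(E/K)[p^{e+1}] = p^{t_p(E) + 2j} · #Ш(E/K)[p^e]`, unconditionally.
[cite: Dokchitser2013ParityNotes, §2] [cite: Greenberg1999LNM, §1 (pp. 54–57)] -/
theorem exists_natCard_sha_torsionBy_pow_succ_eq (e : ℕ) :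
    ∃ j : ℕ, Nat.card (W.sha[((p ^ (e + 1) : ℕ) : ℤ)]) =
      p ^ (W.shaCorank p + 2 * j) * Nat.card (W.sha[((p ^ e : ℕ) : ℤ)]) :=
  Literature.NumberTheory.EllipticCurves.exists_natCard_sha_torsionBy_pow_succ_eq W p
    ShaPrimaryTransferOddDoor.casselsTate_pairing e

/-- **Two consecutive complete descents bound the corank from above, unconditionally**: `#Ш[p^e] = p^a`,
`#Ш[p^{e+1}] = p^b` give `a ≤ b`, `t_p(E) ≤ b − a`, `t_p(E) ≡ b − a (mod 2)`. [cite: Dokchitser2013ParityNotes, §2] -/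
theorem shaCorank_le_sub_of_natCard_eq_pow {e a b : ℕ} (ha : Nat.card (W.sha[((p ^ e : ℕ) : ℤ)]) = p ^ a)
    (hb : Nat.card (W.sha[((p ^ (e + 1) : ℕ) : ℤ)]) = p ^ b) :
    a ≤ b ∧ W.shaCorank p ≤ b - a ∧ W.shaCorank p % 2 = (b - a) % 2 :=
  Literature.NumberTheory.EllipticCurves.shaCorank_le_sub_of_natCard_eq_pow W p
    ShaPrimaryTransferOddDoor.casselsTate_pairing ha hb

/-- **The `(p, p²)` reading table, unconditionally**: `#Ш[p] = p^a`, `#Ш[p²] = p^b` give `b` even, `a ≤ b ≤ 2a`,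
`t_p ≤ b − a`, `t_p ≡ a ≡ b − a (mod 2)`. [cite: Dokchitser2013ParityNotes, §2] [cite: Cassels1962ArithmeticIV, §1] -/
theorem levelTwo_reading {a b : ℕ} (ha : Nat.card (W.sha[(p : ℤ)]) = p ^ a)
    (hb : Nat.card (W.sha[((p ^ 2 : ℕ) : ℤ)]) = p ^ b) :
    Even b ∧ a ≤ b ∧ b ≤ 2 * a ∧ W.shaCorank p ≤ b - a ∧
      W.shaCorank p % 2 = a % 2 ∧ W.shaCorank p % 2 = (b - a) % 2 :=
  Literature.NumberTheory.EllipticCurves.levelTwo_reading W p ShaPrimaryTransferOddDoor.casselsTate_pairing ha hb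

/-- **`t_p(E) = 0 ⟺` the level profile stabilises**, unconditionally. [cite: Greenberg1999LNM, §1 (pp. 54–57)] -/
theorem shaCorank_eq_zero_iff_exists_natCard_succ_eq :
    W.shaCorank p = 0 ↔ ∃ e : ℕ,
      Nat.card (W.sha[((p ^ (e + 1) : ℕ) : ℤ)]) = Nat.card (W.sha[((p ^ e : ℕ) : ℤ)]) :=
  Literature.NumberTheory.EllipticCurves.shaCorank_eq_zero_iff_exists_natCard_succ_eq W p
    ShaPrimaryTransferOddDoor.casselsTate_pairing

/-- **`t_p(E) = 0 ⟺ (#Ш(E/K)[p^e])_e` is bounded**, unconditionally. [cite: Greenberg1999LNM, §1 (pp. 54–57)] -/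
theorem shaCorank_eq_zero_iff_natCard_bounded :
    W.shaCorank p = 0 ↔ ∃ N : ℕ, ∀ e : ℕ, Nat.card (W.sha[((p ^ e : ℕ) : ℤ)]) ≤ N :=
  Literature.NumberTheory.EllipticCurves.shaCorank_eq_zero_iff_natCard_bounded W p
    ShaPrimaryTransferOddDoor.casselsTate_pairing

/-- **The odd step, unconditionally**: `#Ш[p^{e+1}] = p · #Ш[p^e]` certifies `t_p(E) = 1` (an infinite `Ш[p^∞]`).
[cite: Dokchitser2013ParityNotes, §2] -/
theorem shaCorank_eq_one_of_natCard_succ_eq_mul {e : ℕ}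
    (h : Nat.card (W.sha[((p ^ (e + 1) : ℕ) : ℤ)]) = p * Nat.card (W.sha[((p ^ e : ℕ) : ℤ)])) :
    W.shaCorank p = 1 :=
  Literature.NumberTheory.EllipticCurves.shaCorank_eq_one_of_natCard_succ_eq_mul W p
    ShaPrimaryTransferOddDoor.casselsTate_pairing h

end AnyField

/-! ## §2 The second-descent door for the route (`K = ℚ`) -/

section Route

variable (W : WeierstrassCurve ℚ) [W.IsElliptic]

/-- **A stabilised level profile is a witness for O**: if `#Ш(E)[p₀^{e+1}] = #Ш(E)[p₀^e]` at some prime `p₀` and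
level `e` (two consecutive complete `p₀`-power descents agree), then `t_{p₀}(E) = 0` — O's instance on `E` with
witness `p₀`, decided although `Ш(E)[p₀]` may be non-zero (no pairing needed). [cite: Greenberg1999LNM, §1 (pp. 54–57)] -/
theorem door_of_natCard_succ_eq (p : ℕ) [Fact p.Prime] {e : ℕ}
    (h : Nat.card (W.sha[((p ^ (e + 1) : ℕ) : ℤ)]) = Nat.card (W.sha[((p ^ e : ℕ) : ℤ)])) :
    ∃ (p₀ : ℕ) (_ : Fact p₀.Prime), W.shaCorank p₀ = 0 :=
  ⟨p, inferInstance, shaCorank_eq_zero_of_natCard_sha_torsionBy_pow_succ_eq W p h⟩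

/-- **The `4`-descent door**: `#Ш(E)[4] = #Ш(E)[2]` gives `t_2(E) = 0` and `Ш(E)[2^∞] = Ш(E)[2]` (no pairing).
[cite: Greenberg1999LNM, §1 (pp. 54–57)] [cite: SilvermanAEC2009, Thm. X.4.2(b)] -/
theorem shaCorank_two_eq_zero_of_natCard_sha_four_eq
    (h : Nat.card (W.sha[((2 ^ 2 : ℕ) : ℤ)]) = Nat.card (W.sha[((2 : ℕ) : ℤ)])) :
    W.shaCorank 2 = 0 ∧ AddCommGroup.primaryComponent W.sha 2 = W.sha[((2 : ℕ) : ℤ)] := by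
  haveI : Fact (Nat.Prime 2) := ⟨Nat.prime_two⟩
  have h' : Nat.card (W.sha[((2 ^ (1 + 1) : ℕ) : ℤ)]) = Nat.card (W.sha[((2 ^ 1 : ℕ) : ℤ)]) := by
    rw [pow_one]; exact h
  refine ⟨shaCorank_eq_zero_of_natCard_sha_torsionBy_pow_succ_eq W 2 h', ?_⟩
  have := primaryComponent_sha_eq_torsionBy_of_natCard_succ_eq W 2 h'
  rwa [pow_one] at this

/-- **Granting T, one stabilised profile closes every door**: `#Ш(E)[p^{e+1}] = #Ш(E)[p^e] ⟹ t_q(E) = 0` for every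
prime `q`. [cite: Greenberg1999LNM, §1 (pp. 54–57)] -/
theorem transfer_of_natCard_succ_eq (hT : FiniteShaComponentTransfer) (p q : ℕ) [Fact p.Prime] [Fact q.Prime]
    {e : ℕ} (h : Nat.card (W.sha[((p ^ (e + 1) : ℕ) : ℤ)]) = Nat.card (W.sha[((p ^ e : ℕ) : ℤ)])) :
    W.shaCorank q = 0 :=
  hT W p q (shaCorank_eq_zero_of_natCard_sha_torsionBy_pow_succ_eq W p h)

/-- **Granting T, stabilisation at one prime forces stabilisation, boundedness and all-even-exponent squares at
every prime.** [cite: Greenberg1999LNM, §1 (pp. 54–57)] [cite: Dokchitser2013ParityNotes, §2] -/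
theorem forall_exists_natCard_succ_eq_of_transfer (hT : FiniteShaComponentTransfer) (p q : ℕ) [Fact p.Prime]
    [Fact q.Prime] {e : ℕ} (h : Nat.card (W.sha[((p ^ (e + 1) : ℕ) : ℤ)]) = Nat.card (W.sha[((p ^ e : ℕ) : ℤ)])) :
    (∃ e' : ℕ, Nat.card (W.sha[((q ^ (e' + 1) : ℕ) : ℤ)]) = Nat.card (W.sha[((q ^ e' : ℕ) : ℤ)])) ∧
      (∃ N : ℕ, ∀ e' : ℕ, Nat.card (W.sha[((q ^ e' : ℕ) : ℤ)]) ≤ N) ∧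
      ∀ e' : ℕ, IsSquare (Nat.card (W.sha[((q ^ e' : ℕ) : ℤ)])) := by
  have h0 := transfer_of_natCard_succ_eq W hT p q h
  refine ⟨(shaCorank_eq_zero_iff_exists_natCard_succ_eq W q).mp h0,
    (shaCorank_eq_zero_iff_natCard_bounded W q).mp h0, fun e' ↦ ?_⟩
  rw [isSquare_natCard_sha_torsionBy_pow_iff W q e', h0, mul_zero]
  exact ⟨0, rfl⟩

/-! ## §3 T in level-profile currency -/

/-- **T ⟺ «if the level profile of `Ш(E)` stabilises at one prime it stabilises at every prime».**
[cite: Greenberg1999LNM, §1 (pp. 54–57)] -/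
theorem finiteShaComponentTransfer_iff_stabilisation :
    FiniteShaComponentTransfer ↔ ∀ (V : WeierstrassCurve ℚ) [V.IsElliptic] (p q : ℕ) [Fact p.Prime] [Fact q.Prime],
      (∃ e : ℕ, Nat.card (V.sha[((p ^ (e + 1) : ℕ) : ℤ)]) = Nat.card (V.sha[((p ^ e : ℕ) : ℤ)])) →
        ∃ e : ℕ, Nat.card (V.sha[((q ^ (e + 1) : ℕ) : ℤ)]) = Nat.card (V.sha[((q ^ e : ℕ) : ℤ)]) := by
  constructor
  · intro hT V _ p q _ _ hp
    exact (shaCorank_eq_zero_iff_exists_natCard_succ_eq V q).mp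
      (hT V p q ((shaCorank_eq_zero_iff_exists_natCard_succ_eq V p).mpr hp))
  · intro h V _ p q _ _ hp
    exact (shaCorank_eq_zero_iff_exists_natCard_succ_eq V q).mpr
      (h V p q ((shaCorank_eq_zero_iff_exists_natCard_succ_eq V p).mp hp))

/-- **T ⟺ «a bounded level profile at one prime forces a bounded level profile at every prime».**
[cite: Greenberg1999LNM, §1 (pp. 54–57)] -/
theorem finiteShaComponentTransfer_iff_bounded :
    FiniteShaComponentTransfer ↔ ∀ (V : WeierstrassCurve ℚ) [V.IsElliptic] (p q : ℕ) [Fact p.Prime] [Fact q.Prime],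
      (∃ N : ℕ, ∀ e : ℕ, Nat.card (V.sha[((p ^ e : ℕ) : ℤ)]) ≤ N) →
        ∃ N : ℕ, ∀ e : ℕ, Nat.card (V.sha[((q ^ e : ℕ) : ℤ)]) ≤ N := by
  constructor
  · intro hT V _ p q _ _ hp
    exact (shaCorank_eq_zero_iff_natCard_bounded V q).mp (hT V p q ((shaCorank_eq_zero_iff_natCard_bounded V p).mpr hp))
  · intro h V _ p q _ _ hp
    exact (shaCorank_eq_zero_iff_natCard_bounded V q).mpr (h V p q ((shaCorank_eq_zero_iff_natCard_bounded V p).mp hp))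

/-- **The shape of a counterexample to T in level currency**: `¬T` iff some `E/ℚ` has a prime `p` at which the
profile stabilises and a prime `q` at which it never does (then `#Ш(E)[q^{e+1}] ≥ q · #Ш(E)[q^e]` for all large `e`).
[cite: Greenberg1999LNM, §1 (pp. 54–57)] -/
theorem not_finiteShaComponentTransfer_iff :
    ¬ FiniteShaComponentTransfer ↔ ∃ (V : WeierstrassCurve ℚ) (_ : V.IsElliptic) (p q : ℕ) (_ : Fact p.Prime)
      (_ : Fact q.Prime), (∃ e : ℕ, Nat.card (V.sha[((p ^ (e + 1) : ℕ) : ℤ)]) = Nat.card (V.sha[((p ^ e : ℕ) : ℤ)])) ∧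
        ∀ e : ℕ, Nat.card (V.sha[((q ^ (e + 1) : ℕ) : ℤ)]) ≠ Nat.card (V.sha[((q ^ e : ℕ) : ℤ)]) := by
  rw [finiteShaComponentTransfer_iff_stabilisation]
  constructor
  · intro h
    by_contra hne
    apply h
    intro V _ p q _ _ hp
    by_contra hq
    push Not at hq
    exact hne ⟨V, inferInstance, p, q, inferInstance, inferInstance, hp, hq⟩
  · rintro ⟨V, hV, p, q, hp, hq, hst, hnever⟩ h
    obtain ⟨e, he⟩ := @h V hV p q hp hq hst
    exact hnever e he

/-! ## §4 Cross-prime squares -/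

/-- **Granting the `p`-parity theorem at `p` and `q`, the squareness of the descent defect is independent of the
prime at odd levels**: for odd `e`, `e'`, `#Ш(E)[p^e]` is a square iff `#Ш(E)[q^{e'}]` is (both iff `t_p ≡ t_q` is
even: `t_p ≡ t_q (mod 2)`, tree `ShaPrimaryTransferSlices.shaCorank_mod_two_eq_of_p_parity`). At even levels both
are squares with no hypothesis. [cite: DokchitserDokchitserAnnals2010, Thm. 1.4] [cite: Dokchitser2013ParityNotes, §2] -/
theorem isSquare_iff_isSquare_of_p_parity (p q : ℕ) [Fact p.Prime] [Fact q.Prime] (hp : p_parity W p)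
    (hq : p_parity W q) {e e' : ℕ} (he : Odd e) (he' : Odd e') :
    IsSquare (Nat.card (W.sha[((p ^ e : ℕ) : ℤ)])) ↔ IsSquare (Nat.card (W.sha[((q ^ e' : ℕ) : ℤ)])) := by
  rw [isSquare_natCard_sha_torsionBy_pow_iff W p e, isSquare_natCard_sha_torsionBy_pow_iff W q e',
    Nat.even_mul, Nat.even_mul]
  have hpar := ShaPrimaryTransferSlices.shaCorank_mod_two_eq_of_p_parity W p q hp hq
  have h1 : ¬ Even e := Nat.not_even_iff_odd.mpr he
  have h2 : ¬ Even e' := Nat.not_even_iff_odd.mpr he'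
  simp only [h1, h2, false_or]
  rw [Nat.even_iff, Nat.even_iff, hpar]

/-- **Granting T, a closed door at `p` makes every level of every prime a square**: `t_p(E) = 0 ⟹ #Ш(E)[q^e]` is a
square for all `q`, `e` (T's prediction in descent currency, all levels; g13's `…OddDoor` had `e = 1`).
[cite: Dokchitser2013ParityNotes, §2] -/
theorem isSquare_natCard_sha_torsionBy_pow_of_transfer (hT : FiniteShaComponentTransfer) (p q : ℕ) [Fact p.Prime]
    [Fact q.Prime] (h0 : W.shaCorank p = 0) (e : ℕ) : IsSquare (Nat.card (W.sha[((q ^ e : ℕ) : ℤ)])) := by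
  rw [isSquare_natCard_sha_torsionBy_pow_iff W q e, hT W p q h0, mul_zero]
  exact ⟨0, rfl⟩

end Route

/-! ## §5 The isogeny-door table completed: `Ш(X/ℚ)[2^∞] ≅ (ℤ/2ℤ)²` -/

section Table

open ShaPrimaryIsogenyKill

/-- **The isogeny-door table, completed.** For the four carriers of the tree's isogeny-door table — `X₈ = [0,−8,0,1,0]`
(rank 0), `X₁₂₁ = [0,8,0,121,0]` (rank 1), `X₃₄₆ = [0,−346,0,1369,0]`, `X₃₈₈ = [0,−388,0,676,0]` (rank 2) — the
COMPLETE `2`-primary component of `Ш` is `Ш(X/ℚ)[2^∞] = Ш(X/ℚ)[2] ≅ ℤ/2 × ℤ/2`: `#Ш(X/ℚ)[2^e] = 4` for every `e ≥ 1`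
(level profile `m_e = 1`, `t_2(X) = 0`). [cite: SilvermanAEC2009, Prop. X.6.5(b) (the method)]
[cite: MilneADT2006, Ch. I Lemma 7.1(b) (proof), p. 96] -/
theorem isogenyDoorTable_complete [(⟨0, -8, 0, 1, 0⟩ : WeierstrassCurve ℚ).IsElliptic]
    [(⟨0, 8, 0, 121, 0⟩ : WeierstrassCurve ℚ).IsElliptic] [(⟨0, -346, 0, 1369, 0⟩ : WeierstrassCurve ℚ).IsElliptic]
    [(⟨0, -388, 0, 676, 0⟩ : WeierstrassCurve ℚ).IsElliptic] :
    ((∀ e : ℕ, 1 ≤ e → Nat.card ((⟨0, -8, 0, 1, 0⟩ : WeierstrassCurve ℚ).sha[((2 ^ e : ℕ) : ℤ)]) = 4) ∧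
      Nonempty (AddCommGroup.primaryComponent (⟨0, -8, 0, 1, 0⟩ : WeierstrassCurve ℚ).sha 2 ≃+ ZMod 2 × ZMod 2)) ∧
    ((∀ e : ℕ, 1 ≤ e → Nat.card ((⟨0, 8, 0, 121, 0⟩ : WeierstrassCurve ℚ).sha[((2 ^ e : ℕ) : ℤ)]) = 4) ∧
      Nonempty (AddCommGroup.primaryComponent (⟨0, 8, 0, 121, 0⟩ : WeierstrassCurve ℚ).sha 2 ≃+ ZMod 2 × ZMod 2)) ∧
    ((∀ e : ℕ, 1 ≤ e → Nat.card ((⟨0, -346, 0, 1369, 0⟩ : WeierstrassCurve ℚ).sha[((2 ^ e : ℕ) : ℤ)]) = 4) ∧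
      Nonempty (AddCommGroup.primaryComponent (⟨0, -346, 0, 1369, 0⟩ : WeierstrassCurve ℚ).sha 2 ≃+
        ZMod 2 × ZMod 2)) ∧
    ((∀ e : ℕ, 1 ≤ e → Nat.card ((⟨0, -388, 0, 676, 0⟩ : WeierstrassCurve ℚ).sha[((2 ^ e : ℕ) : ℤ)]) = 4) ∧
      Nonempty (AddCommGroup.primaryComponent (⟨0, -388, 0, 676, 0⟩ : WeierstrassCurve ℚ).sha 2 ≃+
        ZMod 2 × ZMod 2)) :=
  ⟨⟨X8_complete.2.2.1, X8_complete.2.2.2⟩, ⟨X121_complete.2.2.1, X121_complete.2.2.2⟩,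
    ⟨X346_complete.2.2.1, X346_complete.2.2.2⟩, ⟨X388_complete.2.2.1, X388_complete.2.2.2⟩⟩

/-- **Granting T, the carriers' profiles at every other prime**: for `X₃₄₆` (rank 2, `t_2 = 0` unconditionally),
`t_q(X₃₄₆) = 0` and `#Ш(X₃₄₆/ℚ)[q^e]` is a square for every prime `q` and every `e` — T's prediction for the
rank-2 carrier in level currency (unconditional at `q = 2`). [cite: Dokchitser2013ParityNotes, §2] -/
theorem isogenyDoorTable_complete_transfer (hT : FiniteShaComponentTransfer)
    [(⟨0, -346, 0, 1369, 0⟩ : WeierstrassCurve ℚ).IsElliptic] (q : ℕ) [Fact q.Prime] (e : ℕ) :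
    (⟨0, -346, 0, 1369, 0⟩ : WeierstrassCurve ℚ).shaCorank q = 0 ∧
      IsSquare (Nat.card ((⟨0, -346, 0, 1369, 0⟩ : WeierstrassCurve ℚ).sha[((q ^ e : ℕ) : ℤ)])) := by
  haveI : Fact (Nat.Prime 2) := ⟨Nat.prime_two⟩
  have h2 : (⟨0, -346, 0, 1369, 0⟩ : WeierstrassCurve ℚ).shaCorank 2 = 0 := Curve346.shaCorank_X_two
  exact ⟨hT _ 2 q h2, isSquare_natCard_sha_torsionBy_pow_of_transfer _ hT 2 q h2 e⟩

end Table

end Summit.BirchSwinnertonDyer.BirchSwinnertonDyer.Theorems.ShaPrimaryTransferLevelProfile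

end
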